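import Mathlib
import HarnessLib
import Summits.NavierStokesRegularity.NavierStokesRegularity.Theses.EulerZoomLiouville
import Summits.NavierStokesRegularity.NavierStokesRegularity.Theorems.EulerZoomLiouvilleSereginZoomReductionOfEulerLimit
import Summits.NavierStokesRegularity.NavierStokesRegularity.Theorems.EulerZoomLiouvilleResidualCalibration

/-!
# Route `EulerZoomLiouville` (№10): the state of the route BY NAME after the conditional discharge of Z

Helper file (theorems only; `--supports stmt-NavierStokesRegularity-19834 --as helper`). Seat ns-typeII-p3
(cell ns-regularity-ideate §B, D-0081). Pure composition of tree theorems; no analysis.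

With `sereginZoomReduction_of_eulerLimit` (Z ⇐ the typed printed theorem
`Seregin2023.seregin2026_typeII_scenario_eulerLimit`, Seregin arXiv:2606.29468 Thm 3.1) and the route's
deciding theorem `closes`, the summit statement follows from the PRINTED FACT plus the three OPEN
conjuncts E (`PowerGaugeEulerLiouville`, the Chae–Shvydkoy-window Liouville theorem), R₁
(`TypeIOrPowerZoomable`, residual) and (L) (`TypeIliouvilleL`, KNSS Liouville conjecture):
`navierStokesRegularity_of_eulerLimit`.  Dropping (L), the same inputs give the §B hard core stmt-0056
(`TypeILiouville.TypeIliouvilleNoTypeII`): `noTypeII_of_eulerLimit`.  These two lines ARE the route's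
current distance to the summit / to N0, kernel-checked.
WHAT THIS IS NOT: not NS and not progress on E, R₁, (L) or Seregin's theorem — bookkeeping. [folklore]
-/

noncomputable section

-- the summit and its single sub-problem share the name (CONVENTIONS §1), as in every Theorems file
set_option linter.dupNamespace false

namespace Summit.NavierStokesRegularity.NavierStokesRegularity.Theorems.EulerZoomLiouvilleStateOfRoute

open Summit.NavierStokesRegularity.NavierStokesRegularity.Theses
open Summit.NavierStokesRegularity.NavierStokesRegularity.Theorems

/-- **Clay (A) from Seregin's printed Euler-zoom theorem + E + R₁ + (L)** (route №10 with its support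
conjunct Z discharged conditionally). [folklore] -/
theorem navierStokesRegularity_of_eulerLimit
    (hThm : Literature.Analysis.FluidPDE.Seregin2023.seregin2026_typeII_scenario_eulerLimit)
    (hE : EulerZoomLiouville.PowerGaugeEulerLiouville) (hR : EulerZoomLiouville.TypeIOrPowerZoomable)
    (hL : EulerZoomLiouville.TypeIliouvilleL) : _root_.NavierStokesRegularity :=
  EulerZoomLiouville.closes hE (SereginZoomReduction.sereginZoomReduction_of_eulerLimit hThm) hR hL

/-- **The hard core stmt-0056 (every first blow-up is Type I) from Seregin's printed Euler-zoom theorem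
+ E + R₁** — no Liouville conjecture (L) needed for this step. [folklore] -/
theorem noTypeII_of_eulerLimit
    (hThm : Literature.Analysis.FluidPDE.Seregin2023.seregin2026_typeII_scenario_eulerLimit)
    (hE : EulerZoomLiouville.PowerGaugeEulerLiouville) (hR : EulerZoomLiouville.TypeIOrPowerZoomable) :
    TypeILiouville.TypeIliouvilleNoTypeII :=
  EulerZoomLiouvilleResidualCalibration.noTypeII_of_conjuncts hE
    (SereginZoomReduction.sereginZoomReduction_of_eulerLimit hThm) hR

end Summit.NavierStokesRegularity.NavierStokesRegularity.Theorems.EulerZoomLiouvilleStateOfRoute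

end
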